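import Summits.QuantumFields.YangMills.Theorems.BalabanUVNodesN07ChartHInvTwistedHerm0
import Summits.QuantumFields.YangMills.Theorems.BalabanUVNodesK0Stub1ChartDAnalytic
import HarnessLib

/-!
# BalabanUVNodes ∕ N07 — [15] PROPOSITION 3 WITH (73)'s EVERY-TWIST DECAY **AND** `𝔤`-REALITY ON ONE `(H, Dfun)`, generic `(P, k)` and AT NODE 00's RECORD — generation 4's END-TO-END
# `exists_chartD_decay_of_kernelRows` RE-RUN on the `𝔤`-valued twisted right inverse of `N07ChartHInvTwistedHerm0` (constants ×3), joined with generation 3's `chartD_valued_herm0`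

Cell `pub-ymgap`, width seat `pub-ymgap-dag-n07-w2` generation 6 (HUMAN RULING D-0149; DAG node N07 = [15] = [Balaban1985Variational]; W-SEAT START LIST §n07 item 2 = S2
«[15] Sect. C (47)–(49), Prop. 3 at objects»; generation 5's located packaging seam (L3): the decay packages (g4 `…ChartDDecayAtRecord` lineage) and the reality packages (g3
`…ChartHValued.exists_prop3_T4_herm0` lineage) were DIFFERENT existential `(H, Dfun)`).  `--kind proof --supports stmt-QuantumFields-27364 --as helper` (K1⁹ face per KEY MAP v2;
count-neutral).  CONSUMED BY NAME, nothing modified: this seat's `N07ChartHInvTwistedHerm0.exists_rightInverse_chartLog_twisted_herm0` (FILE 4 of generation 6), dag k0-s1-w2's `K0Stub1ChartDAnalytic.{contDiffOn_chartD, differentiableOn_fderiv_chartD}` (the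
`C^ω` edition, as in generation 5's `…ChartDDecayAnalytic`), generation 3's
`N07ChartDDerivative.exists_chartD_hasFDerivAt`, `N07ChartDOfRecord.size_chartA_le`, `N07ChartLogReality.chartD_valued_herm0`, generation 4's `N07ChartDDecay.chartD_fderiv_twisted_le`
and `N07ChartDDecayAtRecord.kernelRowsAt_of_adm22_T4`, UST `Prop8Chart.collar_of_adm22`, dag k0-s1-w3's `K0FlatCubeOpsTextP.{flatH, isFlatH_flatH}` — the proof of
`N07ChartHInvTwisted.exists_chartD_decay_of_kernelRows` VERBATIM with the symmetrised operator.

THE PRINT.  [15] p. 285 (51): «We consider configurations A′, X with values in the complexified Lie algebra 𝔤ᶜ»; Prop. 3 p. 289: «The transformation (47) … is defined and analytic …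
The function D(A′) satisfies the bound (55) and its functional derivative satisfies the bound (73)»; (73) «|𝔇(A′; c, b)| ≦ O(1)C₃ε₃(Lʲη)^{−d+1}e^{−(1/2)δ₀d(c₋,y)}»; p. 285 «A with
values in 𝔤».  One `H` (the Landau minimiser) carries all of it in print; here one SYMMETRISED `H♮` does.

WHAT IS PROVED (sorry-free; no definition; axioms standard).
§1 ★★★ `exists_chartD_decay_of_kernelRows_herm0` — generic `(P, k)`, fibre `Matrix (Fin N) (Fin N) ℂ`: binders of generation 4's `exists_chartD_decay_of_kernelRows` with the window
   `18C₂·(3B₀′)·ε ≤ 1` (`B₀′ = C_KB₃(1+2C)(1+2C(1+L))`): ∃ `(H, Dfun)` with `Qlin∘H = 1`, **`H` maps Hermitian-traceless data to Hermitian-traceless fields**, `Dfun` differentiable,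
   `C^ω` with holomorphic `fderiv` on the weighted `ε`-ball, with (55), (49), (48), `HasFDerivAt` + (73) norm level, the EVERY-TWIST decay `e^{δ·dF(i)}‖𝔇W i‖ ≤ 4C₃e^{δr₀}ε·t` under `4C₃e^{δr₀}·3B_e(δ)·ε ≤ 1`,
   **and**, under the guard budget `120ℓ²Lε < δ_N`: Hermitian-traceless `A′` in the ball ⇒ `Dfun A′` and `A′ − H·Dfun A′` Hermitian traceless.
§2 ★★★★ `exists_chartD_decay_herm0_T4` — the same AT NODE 00's RECORD (`F : T4Family`, P2's rows from `kernelRowsAt_of_adm22_T4`, (s1) against the PHYSICAL `distBI D`), binders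
   of generation 4's `exists_chartD_decay_T4` with `3B₀′`.
NOT HERE (by name, mechanical on request): the kernel-entry ∕ reference-bond editions, the analytic edition and generation 5–6's expansions ((73) with ε², `D^{(2)} = C^{(2)}`, (56))
on THIS package — their §2 proofs re-run verbatim on §1∕§2 here.

HONEST FRAMING: count-neutral helper; composition BY NAME of kernel-checked theorems with the symmetrised operator (constants ×3) — NO new estimate of [15]; nothing of
Sects. D–F; stub 1 ∕ K0⁷ ∕ K1⁹ NOT closed; N07 NOT discharged; counts unmoved; one finite T⁴ programme at fixed ε — NOT continuum ∕ ℝ⁴ ∕ OS ∕ mass gap ∕ Clay: the Yang–Mills mass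
gap is NOT proved by any of this; R4 closes the conditional rung `BalabanLadder.UV` only.  No `sorry`, no `def`, no `instance`, no `notation`.

References: [15] T. Bałaban, CMP 102 (1985) 277–309 [Balaban1985Variational] ((45)–(57) pp.285–287, (68)–(73) pp.288–289, Prop. 3 p.289, (161)–(162) p.303); [3] = [B6] CMP 96
(1984) 223–250 [Balaban1984PropagatorsII] (Cor. 2.8 (2.150)–(2.151) p.249); [I] CMP 109 (1987) 249–301 [Balaban1987RG1] ((0.1) p.251).
-/

noncomputable section

open scoped BigOperators Matrix.Norms.L2Operator ContDiff

namespace Summit.QuantumFields.YangMills.BalabanUVNodes.N07ChartDDecayHerm0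

open Literature.MathematicalPhysics.QuantumFieldTheory.Balaban1983to89
open Literature.MathematicalPhysics.QuantumFieldTheory.Balaban1983to89.T4Continuum (T4Family)
open Literature.MathematicalPhysics.QuantumFieldTheory.Balaban1983to89.B6SectADomainsV1 (Domains)
open Literature.MathematicalPhysics.QuantumFieldTheory.Balaban1983to89.B6SectAOperatorsV1 (BondIdx)
open Literature.MathematicalPhysics.QuantumFieldTheory.Balaban1983to89.B9AdOrthogonal (herm0)
open Literature.MathematicalPhysics.QuantumFieldTheory.Balaban1983to89.ExpMeanLog (deltaSU)
open B5Eq118OneStroke (iterBlockOf)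
open Summit.QuantumFields.YangMills.Theorems.FlatCubeOpsText (Adm22 distBI)
open Summit.QuantumFields.YangMills.Theorems.K0FlatCubeOpsTextP (IsFlatH IsLevWeight HKernelRows RowSum162 levWeight_nonneg flatH isFlatH_flatH)
open Summit.QuantumFields.YangMills.Theorems.Prop8Chart (chartLog collar_of_adm22)
open Summit.QuantumFields.YangMills.Theorems.HalvingQuarterCubeSeq (distBI_nonneg)
open Summit.QuantumFields.YangMills.BalabanUVNodes.N07ChartDDecay (chartD_fderiv_twisted_le)
open Summit.QuantumFields.YangMills.BalabanUVNodes.N07ChartDDerivative (exists_chartD_hasFDerivAt)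
open Summit.QuantumFields.YangMills.BalabanUVNodes.N07ChartDOfRecord (size_chartA_le)
open Summit.QuantumFields.YangMills.BalabanUVNodes.N07ChartLogReality (chartD_valued_herm0)
open Summit.QuantumFields.YangMills.BalabanUVNodes.N07ChartDDecayAtRecord (kernelRowsAt_of_adm22_T4)
open Summit.QuantumFields.YangMills.BalabanUVNodes.N07ChartHInvTwistedHerm0 (exists_rightInverse_chartLog_twisted_herm0)
open Summit.QuantumFields.YangMills.Theorems.K0Stub1ChartDAnalytic (contDiffOn_chartD differentiableOn_fderiv_chartD)

variable {P : Params} {N : ℕ} [NeZero N]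

/-! ## §1 Generic `(P, k)`: Prop. 3 + every-twist (73) + reality on one package -/

/-- ★★★ **[15] PROPOSITION 3 WITH (73)'s DECAY AND `𝔤`-REALITY, ONE `(H, Dfun)`, generic carrier** — `N07ChartHInvTwisted.exists_chartD_decay_of_kernelRows` re-run on the
symmetrised operator of `N07ChartHInvTwistedHerm0.exists_rightInverse_chartLog_twisted_herm0` (every constant of `H` ×3), joined with `N07ChartLogReality.chartD_valued_herm0`.  See the
module docstring for the binders and the conclusion. [cite: Balaban1985Variational, (45)-(57) pp.285-287, (68)-(73) pp.288-289, Prop. 3 p.289, (161)-(162) p.303; Balaban1984PropagatorsII, Cor. 2.8 (2.150)-(2.151) p.249] -/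
theorem exists_chartD_decay_of_kernelRows_herm0 (k : ℕ) {R' M : ℕ} (hR'L : 2 * P.L ≤ R') (hM : 1 ≤ M) (D : Domains P) (hDk : D.k = k) (hAdm : Adm22 D R' M)
    {w : ℕ → PBond P 0 → ℝ} (hw : IsLevWeight P k D w) (H₀ : (BondIdx D → ℝ) →ₗ[ℝ] (PBond P 0 → ℝ)) (hH₀ : IsFlatH P k D H₀)
    (dBI : PBond P 0 → BondIdx D → ℝ) (hd0 : ∀ b c, 0 ≤ dBI b c) {CK δ₀ B₃ : ℝ} (hCK : 0 ≤ CK) (hδ₀ : 0 ≤ δ₀) (hB₃ : 0 ≤ B₃)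
    (hker : HKernelRows P k D dBI w H₀ CK δ₀) (h162 : RowSum162 P k D dBI w δ₀ B₃) {ε : ℝ} (hε : 0 < ε)
    (h18 : 18 * (960 * (((P.d + 2) * P.L : ℕ) : ℝ) * (P.L : ℝ) / (12800 * (((P.d + 2) * P.L : ℕ) : ℝ) ^ 2 * (P.L : ℝ))⁻¹) *
      (3 * (CK * B₃ * (1 + 2 * ((P.d + 2) * P.L : ℕ)) * (1 + 2 * ((P.d + 2) * P.L : ℕ) * (1 + P.L)))) * ε ≤ 1)
    (h2 : 64 * ε ≤ (12800 * (((P.d + 2) * P.L : ℕ) : ℝ) ^ 2 * (P.L : ℝ))⁻¹) :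
    let η : ℝ := ((P.L : ℝ)⁻¹) ^ k
    let Rs : ℝ := (12800 * (((P.d + 2) * P.L : ℕ) : ℝ) ^ 2 * (P.L : ℝ))⁻¹
    let C₂ : ℝ := 960 * (((P.d + 2) * P.L : ℕ) : ℝ) * (P.L : ℝ) / Rs
    let C₃ : ℝ := 3840 * (((P.d + 2) * P.L : ℕ) : ℝ) * (P.L : ℝ) / Rs
    let Qlin := (fderiv ℂ (chartLog η D : (PBond P 0 → Matrix (Fin N) (Fin N) ℂ) → BondIdx D → Matrix (Fin N) (Fin N) ℂ) 0)
    ∃ (H : (BondIdx D → Matrix (Fin N) (Fin N) ℂ) →ₗ[ℂ] (PBond P 0 → Matrix (Fin N) (Fin N) ℂ))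
      (Dfun : (PBond P 0 → Matrix (Fin N) (Fin N) ℂ) → (BondIdx D → Matrix (Fin N) (Fin N) ℂ)),
      (∀ X, Qlin (H X) = X) ∧
      (∀ (X : BondIdx D → Matrix (Fin N) (Fin N) ℂ) (t : ℝ), 0 ≤ t → (∀ i, ‖X i‖ ≤ t) → ∀ b,
        w 1 b * ‖H X b‖ ≤ 3 * (CK * B₃ * (1 + 2 * ((P.d + 2) * P.L : ℕ)) * (1 + 2 * ((P.d + 2) * P.L : ℕ) * (1 + P.L))) * t) ∧
      (∀ X : BondIdx D → Matrix (Fin N) (Fin N) ℂ, (∀ i, X i ∈ herm0 (Fin N)) → ∀ b, H X b ∈ herm0 (Fin N)) ∧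
      DifferentiableOn ℂ Dfun {A' : PBond P 0 → Matrix (Fin N) (Fin N) ℂ | ∀ b, w 1 b * ‖A' b‖ < ε} ∧
      ContDiffOn ℂ ω Dfun {A' : PBond P 0 → Matrix (Fin N) (Fin N) ℂ | ∀ b, w 1 b * ‖A' b‖ < ε} ∧
      DifferentiableOn ℂ (fderiv ℂ Dfun) {A' : PBond P 0 → Matrix (Fin N) (Fin N) ℂ | ∀ b, w 1 b * ‖A' b‖ < ε} ∧
      (∀ A' : PBond P 0 → Matrix (Fin N) (Fin N) ℂ, (∀ b, w 1 b * ‖A' b‖ < ε) →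
        (∀ (ρ : ℝ), 0 ≤ ρ → (∀ b, w 1 b * ‖A' b‖ ≤ ρ) → ∀ i, ‖Dfun A' i‖ ≤ 4 * C₂ * ρ ^ 2) ∧
        chartLog η D (A' - H (Dfun A')) - Qlin (A' - H (Dfun A')) = Dfun A' ∧
        chartLog η D (A' - H (Dfun A')) = Qlin A' ∧
        ∃ 𝔇 : (PBond P 0 → Matrix (Fin N) (Fin N) ℂ) →L[ℂ] (BondIdx D → Matrix (Fin N) (Fin N) ℂ), HasFDerivAt Dfun 𝔇 A' ∧
          (∀ (W : PBond P 0 → Matrix (Fin N) (Fin N) ℂ) (t : ℝ), 0 ≤ t → (∀ b, w 1 b * ‖W b‖ ≤ t) → ∀ i, ‖𝔇 W i‖ ≤ 4 * C₃ * ε * t) ∧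
          ∀ (dE : PBond P 0 → ℝ) (dF : BondIdx D → ℝ) (δ r₀ r₁ r₂ : ℝ), 0 ≤ δ → δ ≤ δ₀ / 2 →
            (∀ b c, dE b ≤ dBI b c + dF c) →
            (∀ (i c : BondIdx D) (x : Site P 0),
              (iterBlockOf (i.1.1 : ℕ) x = i.1.2.src ∨ iterBlockOf (i.1.1 : ℕ) x = i.1.2.tgt) →
              (iterBlockOf (c.1.1 : ℕ) x = c.1.2.src ∨ iterBlockOf (c.1.1 : ℕ) x = c.1.2.tgt) → dF i ≤ dF c + r₁) →
            (∀ (b b' : PBond P 0) (x : Site P 0) (j : ℕ), (x = b.src ∨ x = b.tgt) → j ≤ D.k →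
              iterBlockOf j b'.src = iterBlockOf j x → dE b ≤ dE b' + r₂) →
            (∀ (idx : BondIdx D) (b : PBond P 0),
              (iterBlockOf (idx.1.1 : ℕ) b.src = idx.1.2.src ∨ iterBlockOf (idx.1.1 : ℕ) b.src = idx.1.2.tgt) →
              (iterBlockOf (idx.1.1 : ℕ) b.tgt = idx.1.2.src ∨ iterBlockOf (idx.1.1 : ℕ) b.tgt = idx.1.2.tgt) → dF idx ≤ dE b + r₀) →
            4 * C₃ * Real.exp (δ * r₀) *
                (3 * (CK * B₃ * (1 + 2 * ((P.d + 2) * P.L : ℕ) * Real.exp (δ * r₁)) * (1 + 2 * ((P.d + 2) * P.L : ℕ) * (1 + P.L) * Real.exp (δ * r₂)))) * ε ≤ 1 →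
            ∀ (W : PBond P 0 → Matrix (Fin N) (Fin N) ℂ) (t : ℝ), 0 ≤ t → (∀ b, Real.exp (δ * dE b) * (w 1 b * ‖W b‖) ≤ t) →
              ∀ i, Real.exp (δ * dF i) * ‖𝔇 W i‖ ≤ 4 * C₃ * Real.exp (δ * r₀) * ε * t) ∧
      ((120 * (((P.d + 2) * P.L : ℕ) : ℝ) ^ 2 * (P.L : ℝ) * ε < deltaSU (Fin N)) →
        ∀ A' : PBond P 0 → Matrix (Fin N) (Fin N) ℂ, (∀ b, w 1 b * ‖A' b‖ < ε) → (∀ b, A' b ∈ herm0 (Fin N)) →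
          (∀ i, Dfun A' i ∈ herm0 (Fin N)) ∧ ∀ b, (A' - H (Dfun A')) b ∈ herm0 (Fin N)) := by
  -- adapted verbatim from generation 4's `N07ChartHInvTwisted.exists_chartD_decay_of_kernelRows` (the symmetrised `H`, constants ×3), + reality
  intro η Rs C₂ C₃ Qlin
  have hL0 : (0 : ℝ) < P.L := by exact_mod_cast P.L_pos
  have hℓ1 : (1 : ℝ) ≤ (((P.d + 2) * P.L : ℕ) : ℝ) := by
    exact_mod_cast Nat.one_le_iff_ne_zero.mpr (Nat.mul_ne_zero (by omega) (by have := P.hL.2; omega))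
  have hden : 0 < 12800 * (((P.d + 2) * P.L : ℕ) : ℝ) ^ 2 * (P.L : ℝ) := by positivity
  have hRs0 : 0 < Rs := inv_pos.mpr hden
  have hC₂ : 0 ≤ C₂ := by show 0 ≤ 960 * (((P.d + 2) * P.L : ℕ) : ℝ) * (P.L : ℝ) / Rs; positivity
  have hwpos : ∀ b, 0 < w 1 b := fun b => by rw [hw 1 b, pow_one]; positivity
  have hRM : 2 * P.L ≤ R' * M + 1 := by have : R' ≤ R' * M := Nat.le_mul_of_pos_right R' hM; omega
  have hcollar := collar_of_adm22 D hAdm hRM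
  set B₀' : ℝ := 3 * (CK * B₃ * (1 + 2 * ((P.d + 2) * P.L : ℕ)) * (1 + 2 * ((P.d + 2) * P.L : ℕ) * (1 + P.L))) with hB₀'
  have hB₀'0 : 0 ≤ B₀' := by positivity
  obtain ⟨H, hHinv, hsup, htw, hherm⟩ :=
    exists_rightInverse_chartLog_twisted_herm0 (N := N) k D hDk hAdm hRM w hw H₀ hH₀ dBI hd0 hCK hδ₀ hB₃ hker h162
  have hsup' : ∀ (X : BondIdx D → Matrix (Fin N) (Fin N) ℂ) (t : ℝ), 0 ≤ t → (∀ i, ‖X i‖ ≤ t) → ∀ b, w 1 b * ‖H X b‖ ≤ B₀' * t := hsup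
  obtain ⟨Dfun, hdiff, hDfun⟩ := exists_chartD_hasFDerivAt k hR'L hM D hDk hAdm hw H hHinv hB₀'0 hsup' hε h18 h2
  -- k0-s1-w2: every (55)+(49) solution family on this `H` is `C^ω`, with holomorphic `fderiv`
  have h55' := fun A' (hA' : ∀ b, w 1 b * ‖A' b‖ < ε) => (hDfun A' hA').1
  have h49' := fun A' (hA' : ∀ b, w 1 b * ‖A' b‖ < ε) => (hDfun A' hA').2.1
  have hω : ContDiffOn ℂ ω Dfun {A' : PBond P 0 → Matrix (Fin N) (Fin N) ℂ | ∀ b, w 1 b * ‖A' b‖ < ε} :=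
    contDiffOn_chartD k hR'L hM D hDk hAdm hw H hHinv hB₀'0 hsup' hε h18 h2 Dfun h55' h49'
  have hfd : DifferentiableOn ℂ (fderiv ℂ Dfun) {A' : PBond P 0 → Matrix (Fin N) (Fin N) ℂ | ∀ b, w 1 b * ‖A' b‖ < ε} :=
    differentiableOn_fderiv_chartD k hR'L hM D hDk hAdm hw H hHinv hB₀'0 hsup' hε h18 h2 Dfun h55' h49'
  refine ⟨H, Dfun, hHinv, hsup, hherm, hdiff, hω, hfd, fun A' hA' => ?_, fun hδ A' hA' hA'h => ?_⟩
  · obtain ⟨h55, h49, h48, 𝔇, h𝔇, h73⟩ := hDfun A' hA'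
    refine ⟨h55, h49, h48, 𝔇, h𝔇, h73, fun dE dF δ r₀ r₁ r₂ hδ hδh htri hF hE hread hsmall W t ht hW i => ?_⟩
    -- (57): the chart point has weighted size `≤ 2ε`
    have h4 : 4 * C₂ * B₀' * ε ≤ 1 := by
      have h18' : 18 * C₂ * B₀' * ε ≤ 1 := h18
      nlinarith [mul_nonneg (mul_nonneg hC₂ hB₀'0) hε.le]
    have hX₀ : ∀ b, w 1 b * ‖(A' - H (Dfun A')) b‖ ≤ 2 * ε := fun b => by
      have h := size_chartA_le hwpos H hC₂ hB₀'0 hsup' (fun b => (hA' b).le) (h55 ε hε.le fun b => (hA' b).le) b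
      have : B₀' * (4 * C₂ * ε ^ 2) ≤ ε := by nlinarith [mul_nonneg (mul_nonneg hC₂ hB₀'0) hε.le]
      linarith
    have h16 : 16 * ε ≤ Rs := by show 16 * ε ≤ (12800 * (((P.d + 2) * P.L : ℕ) : ℝ) ^ 2 * (P.L : ℝ))⁻¹; linarith
    -- the exponential twists are read-compatible with `κ = e^{δr₀}`
    have hκ : ∀ (idx : BondIdx D) (b : PBond P 0),
        (iterBlockOf (idx.1.1 : ℕ) b.src = idx.1.2.src ∨ iterBlockOf (idx.1.1 : ℕ) b.src = idx.1.2.tgt) →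
        (iterBlockOf (idx.1.1 : ℕ) b.tgt = idx.1.2.src ∨ iterBlockOf (idx.1.1 : ℕ) b.tgt = idx.1.2.tgt) →
        Real.exp (δ * dF idx) ≤ Real.exp (δ * r₀) * Real.exp (δ * dE b) := by
      intro idx b hs ht'
      rw [← Real.exp_add]
      exact Real.exp_le_exp.mpr (by nlinarith [mul_le_mul_of_nonneg_left (hread idx b hs ht') hδ])
    have hBe : 0 ≤ 3 * (CK * B₃ * (1 + 2 * ((P.d + 2) * P.L : ℕ) * Real.exp (δ * r₁)) * (1 + 2 * ((P.d + 2) * P.L : ℕ) * (1 + P.L) * Real.exp (δ * r₂))) := by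
      positivity
    exact chartD_fderiv_twisted_le k D hDk hcollar hw H hε h16 Dfun (fun A hA => (hDfun A hA).2.1) hA' hX₀ h𝔇
      (fun b => Real.exp (δ * dE b)) (fun c => Real.exp (δ * dF c)) (fun b => Real.exp_pos _) (fun c => Real.exp_pos _) (Real.exp_pos _).le hκ hBe
      (htw dE dF δ r₁ r₂ hδ hδh htri hF hE) hsmall W t ht hW i
  · -- reality on the same package
    exact chartD_valued_herm0 k hR'L hM D hDk hAdm hw H hB₀'0 hsup' hε h18 h2 hδ hherm Dfun (fun A hA => (hDfun A hA).1)
      (fun A hA => (hDfun A hA).2.1) A' hA' hA'h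

/-! ## §2 At NODE 00's record -/

/-- ★★★★ **[15] PROPOSITION 3 WITH (73)'s EVERY-TWIST DECAY AND `𝔤`-REALITY ON ONE `(H, Dfun)`, AT NODE 00's RECORD — NO displayed operator hypothesis.**  For every `F : T4Family`:
thresholds `M_h⁰, R₀` and constants `C_K ≥ 0`, `δ₀ > 0`, `B₃ > 0` (P2's kernel rows on the four-tori); for all heights, big blocks, `R ≥ max R₀ 2L`, every nested family `D` on NODE 00's
torus with `Adm22 D R (L·M_h)`, every level-weight family `w`, every `ε > 0` in the window `18C₂(3B₀′)ε ≤ 1`, `64ε ≤ R⋆`: THERE ARE the symmetrised route right inverse `H` (right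
inverse; sup letter `3B₀′`; Hermitian-traceless data ↦ Hermitian-traceless fields) and the chart map `Dfun` with (55), (49), (48), `HasFDerivAt`, the norm-level (73), the EVERY-TWIST
decay against the PHYSICAL `distBI D` ((s1)–(s4), `4C₃e^{δr₀}·3B_e(δ)·ε ≤ 1`), AND — under the guard budget `120ℓ²Lε < δ_N` — reality: Hermitian-traceless `A′` in the ball ⇒
`Dfun A′`, `A′ − H·Dfun A′` Hermitian traceless.  §1 + `N07ChartDDecayAtRecord.kernelRowsAt_of_adm22_T4` (the port's `dBI ≥ distBI` absorbed).
[cite: Balaban1985Variational, (45)-(57) pp.285-287, (68)-(73) pp.288-289, Prop. 3 p.289, (161)-(162) p.303; Balaban1984PropagatorsII, Lemma 2.1 p.232, Cor. 2.8 (2.150)-(2.151) p.249; Balaban1987RG1, (0.1) p.251, (0.4) p.253] -/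
theorem exists_chartD_decay_herm0_T4 (F : T4Family) :
    ∃ (Mh₀ R₀ : ℕ) (CK δ₀ B₃ : ℝ), 0 ≤ CK ∧ 0 < δ₀ ∧ 0 < B₃ ∧
    ∀ (n K : ℕ) (_ : 1 ≤ K - n) (_ : K - n + 1 ≤ F.m + K) {Mh R a' : ℕ} (_ : Mh = F.L ^ a') (_ : Mh₀ ≤ Mh) (_ : R₀ ≤ R) (_ : 2 * F.L ≤ R)
      (_ : a' + 3 ≤ F.m + n) (D : Domains (F.P K)) (_ : D.k = K - n) (_ : Adm22 D R (F.L * Mh))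
      (w : ℕ → PBond (F.P K) 0 → ℝ) (_ : IsLevWeight (F.P K) (K - n) D w) {ε : ℝ} (_ : 0 < ε)
      (_ : 18 * (960 * ((((F.P K).d + 2) * (F.P K).L : ℕ) : ℝ) * ((F.P K).L : ℝ) / (12800 * ((((F.P K).d + 2) * (F.P K).L : ℕ) : ℝ) ^ 2 * ((F.P K).L : ℝ))⁻¹) *
        (3 * (CK * B₃ * (1 + 2 * (((F.P K).d + 2) * (F.P K).L : ℕ)) * (1 + 2 * (((F.P K).d + 2) * (F.P K).L : ℕ) * (1 + (F.P K).L)))) * ε ≤ 1)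
      (_ : 64 * ε ≤ (12800 * ((((F.P K).d + 2) * (F.P K).L : ℕ) : ℝ) ^ 2 * ((F.P K).L : ℝ))⁻¹),
      let η : ℝ := (((F.P K).L : ℝ)⁻¹) ^ (K - n)
      let Rs : ℝ := (12800 * ((((F.P K).d + 2) * (F.P K).L : ℕ) : ℝ) ^ 2 * ((F.P K).L : ℝ))⁻¹
      let C₂ : ℝ := 960 * ((((F.P K).d + 2) * (F.P K).L : ℕ) : ℝ) * ((F.P K).L : ℝ) / Rs
      let C₃ : ℝ := 3840 * ((((F.P K).d + 2) * (F.P K).L : ℕ) : ℝ) * ((F.P K).L : ℝ) / Rs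
      let Qlin := (fderiv ℂ (chartLog η D : (PBond (F.P K) 0 → Matrix (Fin N) (Fin N) ℂ) → BondIdx D → Matrix (Fin N) (Fin N) ℂ) 0)
      ∃ (H : (BondIdx D → Matrix (Fin N) (Fin N) ℂ) →ₗ[ℂ] (PBond (F.P K) 0 → Matrix (Fin N) (Fin N) ℂ))
        (Dfun : (PBond (F.P K) 0 → Matrix (Fin N) (Fin N) ℂ) → (BondIdx D → Matrix (Fin N) (Fin N) ℂ)),
        (∀ X, Qlin (H X) = X) ∧
        (∀ (X : BondIdx D → Matrix (Fin N) (Fin N) ℂ) (t : ℝ), 0 ≤ t → (∀ i, ‖X i‖ ≤ t) → ∀ b,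
          w 1 b * ‖H X b‖ ≤ 3 * (CK * B₃ * (1 + 2 * (((F.P K).d + 2) * (F.P K).L : ℕ)) * (1 + 2 * (((F.P K).d + 2) * (F.P K).L : ℕ) * (1 + (F.P K).L))) * t) ∧
        (∀ X : BondIdx D → Matrix (Fin N) (Fin N) ℂ, (∀ i, X i ∈ herm0 (Fin N)) → ∀ b, H X b ∈ herm0 (Fin N)) ∧
        DifferentiableOn ℂ Dfun {A' : PBond (F.P K) 0 → Matrix (Fin N) (Fin N) ℂ | ∀ b, w 1 b * ‖A' b‖ < ε} ∧
        ContDiffOn ℂ ω Dfun {A' : PBond (F.P K) 0 → Matrix (Fin N) (Fin N) ℂ | ∀ b, w 1 b * ‖A' b‖ < ε} ∧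
        DifferentiableOn ℂ (fderiv ℂ Dfun) {A' : PBond (F.P K) 0 → Matrix (Fin N) (Fin N) ℂ | ∀ b, w 1 b * ‖A' b‖ < ε} ∧
        (∀ A' : PBond (F.P K) 0 → Matrix (Fin N) (Fin N) ℂ, (∀ b, w 1 b * ‖A' b‖ < ε) →
          (∀ (ρ : ℝ), 0 ≤ ρ → (∀ b, w 1 b * ‖A' b‖ ≤ ρ) → ∀ i, ‖Dfun A' i‖ ≤ 4 * C₂ * ρ ^ 2) ∧
          chartLog η D (A' - H (Dfun A')) - Qlin (A' - H (Dfun A')) = Dfun A' ∧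
          chartLog η D (A' - H (Dfun A')) = Qlin A' ∧
          ∃ 𝔇 : (PBond (F.P K) 0 → Matrix (Fin N) (Fin N) ℂ) →L[ℂ] (BondIdx D → Matrix (Fin N) (Fin N) ℂ), HasFDerivAt Dfun 𝔇 A' ∧
            (∀ (W : PBond (F.P K) 0 → Matrix (Fin N) (Fin N) ℂ) (t : ℝ), 0 ≤ t → (∀ b, w 1 b * ‖W b‖ ≤ t) → ∀ i, ‖𝔇 W i‖ ≤ 4 * C₃ * ε * t) ∧
            ∀ (dE : PBond (F.P K) 0 → ℝ) (dF : BondIdx D → ℝ) (δ r₀ r₁ r₂ : ℝ), 0 ≤ δ → δ ≤ δ₀ / 2 →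
              (∀ b c, dE b ≤ distBI D b c + dF c) →
              (∀ (i c : BondIdx D) (x : Site (F.P K) 0),
                (iterBlockOf (i.1.1 : ℕ) x = i.1.2.src ∨ iterBlockOf (i.1.1 : ℕ) x = i.1.2.tgt) →
                (iterBlockOf (c.1.1 : ℕ) x = c.1.2.src ∨ iterBlockOf (c.1.1 : ℕ) x = c.1.2.tgt) → dF i ≤ dF c + r₁) →
              (∀ (b b' : PBond (F.P K) 0) (x : Site (F.P K) 0) (j : ℕ), (x = b.src ∨ x = b.tgt) → j ≤ D.k →
                iterBlockOf j b'.src = iterBlockOf j x → dE b ≤ dE b' + r₂) →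
              (∀ (idx : BondIdx D) (b : PBond (F.P K) 0),
                (iterBlockOf (idx.1.1 : ℕ) b.src = idx.1.2.src ∨ iterBlockOf (idx.1.1 : ℕ) b.src = idx.1.2.tgt) →
                (iterBlockOf (idx.1.1 : ℕ) b.tgt = idx.1.2.src ∨ iterBlockOf (idx.1.1 : ℕ) b.tgt = idx.1.2.tgt) → dF idx ≤ dE b + r₀) →
              4 * C₃ * Real.exp (δ * r₀) *
                  (3 * (CK * B₃ * (1 + 2 * (((F.P K).d + 2) * (F.P K).L : ℕ) * Real.exp (δ * r₁)) *
                    (1 + 2 * (((F.P K).d + 2) * (F.P K).L : ℕ) * (1 + (F.P K).L) * Real.exp (δ * r₂)))) * ε ≤ 1 →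
              ∀ (W : PBond (F.P K) 0 → Matrix (Fin N) (Fin N) ℂ) (t : ℝ), 0 ≤ t → (∀ b, Real.exp (δ * dE b) * (w 1 b * ‖W b‖) ≤ t) →
                ∀ i, Real.exp (δ * dF i) * ‖𝔇 W i‖ ≤ 4 * C₃ * Real.exp (δ * r₀) * ε * t) ∧
        ((120 * ((((F.P K).d + 2) * (F.P K).L : ℕ) : ℝ) ^ 2 * ((F.P K).L : ℝ) * ε < deltaSU (Fin N)) →
          ∀ A' : PBond (F.P K) 0 → Matrix (Fin N) (Fin N) ℂ, (∀ b, w 1 b * ‖A' b‖ < ε) → (∀ b, A' b ∈ herm0 (Fin N)) →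
            (∀ i, Dfun A' i ∈ herm0 (Fin N)) ∧ ∀ b, (A' - H (Dfun A')) b ∈ herm0 (Fin N)) := by
  obtain ⟨Mh₀, R₀, CK, δ₀, B₃, CG, hCK, hδ₀, hB₃, -, hmain⟩ := kernelRowsAt_of_adm22_T4 F
  refine ⟨Mh₀, R₀, CK, δ₀, B₃, hCK, hδ₀, hB₃, ?_⟩
  intro n K hk1 hk' Mh R a' hMha hMh hR h2L hsize D hDk hAdm w hw ε hε h18 h2 η Rs C₂ C₃ Qlin
  obtain ⟨⟨dBI, hdist, h162, hker⟩, -⟩ := hmain n K hk1 hk' hMha hMh hR hsize D hDk hAdm w hw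
  have hd0 : ∀ b c, 0 ≤ dBI b c := fun b c => (distBI_nonneg D b c).trans (hdist b c)
  have hL1 : 1 ≤ F.L := by have := F.hL11; omega
  have hM : 1 ≤ F.L * Mh := by
    rw [hMha]; exact Nat.one_le_iff_ne_zero.mpr (Nat.mul_ne_zero (by omega) (pow_ne_zero _ (by omega)))
  obtain ⟨H, Dfun, hHinv, hsup, hherm, hdiff, hω, hfd, hDfun, hreal⟩ := exists_chartD_decay_of_kernelRows_herm0 (N := N) (K - n) h2L hM D hDk hAdm hw
    (flatH (F.P K) (K - n) D) (isFlatH_flatH (F.P K) (K - n) D) dBI hd0 hCK hδ₀.le hB₃.le hker h162 hε h18 h2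
  refine ⟨H, Dfun, hHinv, hsup, hherm, hdiff, hω, hfd, fun A' hA' => ?_, hreal⟩
  obtain ⟨h55, h49, h48, 𝔇, h𝔇, h73, htw⟩ := hDfun A' hA'
  refine ⟨h55, h49, h48, 𝔇, h𝔇, h73, fun dE dF δ r₀ r₁ r₂ hδ hδh htri hF hE hread hsmall W t ht hW i => ?_⟩
  exact htw dE dF δ r₀ r₁ r₂ hδ hδh (fun b c => (htri b c).trans (by linarith [hdist b c])) hF hE hread hsmall W t ht hW i

end Summit.QuantumFields.YangMills.BalabanUVNodes.N07ChartDDecayHerm0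

end
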